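import Summits.ResolutionOfSingularities.ResolutionOfSingularities.Theorems.EquisingularLiftEquisingularLiftNatCentredConeLift
import Summits.ResolutionOfSingularities.ResolutionOfSingularities.Theorems.EquisingularLiftEquisingularLiftNatSectionFrameAdaptedOfFrame
import Summits.ResolutionOfSingularities.ResolutionOfSingularities.Theorems.EquisingularLiftEquisingularLiftNatConeFormTransport
import HarnessLib

/-!
# [OURS · L1 W4.5(b) · EL♮(3)] S7 — B4a★′: THE CENTRED CONE LIFT over the `ConeForm`-LIFTED ADAPTED FRAME, (vii-loc) exported
# (crux `EquisingularLiftNatThree` = stmt-ResolutionOfSingularities-20148)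

res-type-100 g12, object S7 `hBaseKCL` (res-D-pv-029 TOWER₃ assembly; res-L1-w45b-plan-1 CHAIN v7.31 §1(1); currency `TCPlus.MemberKCL`,
p570160). OURS; NOT a statement of any manuscript; AI-written, weaker than expert review; `--supports stmt-ResolutionOfSingularities-20148
--as helper`; closes nothing. Definition-free. `exists_centredConeLift_three_exact_coneForm` = res-type-100's B4a★
`exists_centredConeLift_three_exact` (…NatCentredConeLiftExact) RE-RUN with (S1″) the adapted frame from T-FRAME-AT′
(…NatSectionFrameAdaptedOfFrame) STARTING FROM the section-frame lift of the `ConeForm` frame (res-D-pv-051), (S2‴) the local equation =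
the cone form of `W` transported to that frame (…NatConeFormTransport; characteristic `p`), everything else VERBATIM; plus, for every cone
ideal `K₀` with the prescribed germ, (vii-loc) `∃ V ⊇ υ⁻¹{x}` open with `((St_{τ₁} K₀)·𝒪_{F₂})|_V = 𝓘⟨closure υ⁻¹(W ∖ {x})⟩|_V`
(…NatConeFormConstants `span_eval_map_eq_of_reduction_of_map_eq` + …NatConeShadowLocal). Hypotheses: B4a★'s with `x ∈ W` and the principal
affine open REPLACED by `ConeForm F₁ x W`, and `[CharP k p]`. References: Matsumura (1986) Thm. 14.2; Stacks Tag 0804 — via the cited files.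
-/

set_option linter.dupNamespace false -- mandated namespace `Summit.<Summit>.<Problem>` of this single-conjunct summit
set_option linter.overlappingInstances false -- the binders carry `[IsDomain O] [IsDiscreteValuationRing O]`

noncomputable section

open CategoryTheory CategoryTheory.Limits AlgebraicGeometry TopologicalSpace IsLocalRing
open Literature.AlgebraicGeometry.Resolution
open AlgebraicGeometry.Scheme.IdealSheafData
open Summit.ResolutionOfSingularities.ResolutionOfSingularities.Cruxes.EquisingularLift.StrataSplit

namespace Summit.ResolutionOfSingularities.ResolutionOfSingularities.Cruxes.EquisingularLiftNat.Sections

section Centred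

set_option maxHeartbeats 800000 in -- long assembly over the chart algebra `blowupAlgebra` (slow instance unification, cf. p509910 / p527425)
/-- **THE CENTRED CONE LIFT AT A CLOSED POINT OF THE TRACE over the `ConeForm`-lifted adapted frame, with the exact-order clause and
(vii-loc)** (`n = 3`; see the module docstring). [cite: Matsumura1987, Thm. 14.2; StacksProject, Tag 0804] [OURS · L1 W4.5b] S7 centred
chain; NOT a statement of the manuscript. -/
theorem exists_centredConeLift_three_exact_coneForm (p : ℕ) [Fact p.Prime] (k : Type) [Field k] [CharP k p] [IsAlgClosed k] (O : Type) [CommRing O] [IsDomain O]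
    [IsDiscreteValuationRing O] [IsAdicComplete (IsLocalRing.maximalIdeal O) O] [IsAlgClosed (IsLocalRing.ResidueField O)]
    (θ : O →+* k) (hθ : Function.Surjective θ) (X' : Scheme.{0}) (r' : X' ⟶ Spec (.of O)) [IsIntegral X'] [IsLocallyNoetherian X']
    (hregX : Scheme.IsRegular X') [IsProper r']
    (s : Spec (.of O) ⟶ X') (hs : s ≫ r' = 𝟙 _)
    (hdim4 : ringKrullDim (X'.presheaf.stalk (s (IsLocalRing.closedPoint O))) = ((3 + 1 : ℕ) : WithBot ℕ∞))
    (X₁ : Scheme.{0}) (τ₁ : X₁ ⟶ X') (hτ₁ : IsBlowup τ₁ s.ker) (F₁ : Scheme.{0}) [IsIntegral F₁] (j : F₁ ⟶ X')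
    (t : F₁ ⟶ Spec (.of k)) (hsq : IsPullback j t r' (Spec.map (CommRingCat.ofHom θ))) (x : F₁) (hx : IsClosed ({x} : Set F₁))
    (hss : s (IsLocalRing.closedPoint O) = j x) (F₂ : Scheme.{0}) [IsIntegral F₂] (υ : F₂ ⟶ F₁)
    (hυ : IsBlowup υ (vanishingIdeal (⟨{x}, hx⟩ : Closeds F₁))) (j₂ : F₂ ⟶ X₁) (hcomm : j₂ ≫ τ₁ = υ ≫ j)
    (W : Set F₁) (hZ : IsClosed (υ ⁻¹' {x} ∩ closure (υ ⁻¹' (W \ {x}))))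
    (hnot : ¬ (υ ⁻¹' {x} ⊆ closure (υ ⁻¹' (W \ {x})))) (hcone : ConeForm F₁ x W)
    (y' : F₂) (hy' : y' ∈ υ ⁻¹' {x} ∩ closure (υ ⁻¹' (W \ {x}))) (hy'c : IsClosed ({y'} : Set F₂)) :
    ∃ (c : Fin 3 → X'.presheaf.stalk (j x)) (θR : (X'.presheaf.stalk (j x) ⧸ Ideal.span (Set.range c)) ≃+* O)
      (d m : ℕ) (Φ : MvPolynomial (Fin 3) O) (Φu Φv : MvPolynomial (Fin 2) O),
      -- the section frame at `j x`
      Ideal.span (Set.range c) = stalkIdeal s.ker (j x) ∧ IsQuasiRegular c ∧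
      IsDomain (X'.presheaf.stalk (j x) ⧸ Ideal.span (Set.range c)) ∧
      (∀ b : O, θR (Ideal.Quotient.mk _ ((X'.presheaf.Γgerm (j x)).hom (r'.appTop.hom ((Scheme.ΓSpecIso (.of O)).inv.hom b)))) = b) ∧
      (∀ ϖ : O, Irreducible ϖ →
        Ideal.span (Set.range c) ⊔ Ideal.span {(X'.presheaf.Γgerm (j x)).hom (r'.appTop.hom ((Scheme.ΓSpecIso (.of O)).inv.hom ϖ))} =
          maximalIdeal (X'.presheaf.stalk (j x)) ∧
        (X'.presheaf.Γgerm (j x)).hom (r'.appTop.hom ((Scheme.ΓSpecIso (.of O)).inv.hom ϖ)) ∉ Ideal.span (Set.range c)) ∧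
      -- the model frame downstairs
      Ideal.span (Set.range fun i => (j.stalkMap x).hom (c i)) = maximalIdeal (F₁.presheaf.stalk x) ∧
      IsQuasiRegular (fun i => (j.stalkMap x).hom (c i)) ∧
      -- the presentation of `𝒪_{F₂,y′}` on the chart `c̄₀`, the other two coordinates vanishing at `y′` (T-FRAME-AT verbatim)
      (∃ (𝔔 : PrimeSpectrum (blowupAlgebra (Ideal.span (Set.range fun i => (j.stalkMap x).hom (c i)))
          ((j.stalkMap x).hom (c 0))))
        (χ : blowupAlgebra (Ideal.span (Set.range fun i => (j.stalkMap x).hom (c i))) ((j.stalkMap x).hom (c 0)) →+*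
          F₂.presheaf.stalk y')
        (e : F₂.presheaf.stalk y' ≃+* Localization.AtPrime 𝔔.asIdeal),
        (∀ a, χ (algebraMap _ _ a) =
          ((F₁.presheaf.stalkCongr (Inseparable.of_eq (show υ y' = x from hy'.1))).inv ≫ υ.stalkMap y').hom a) ∧
        @IsLocalization.AtPrime _ _ (F₂.presheaf.stalk y') _ χ.toAlgebra 𝔔.asIdeal _ ∧
        (∀ b, e (χ b) = algebraMap _ (Localization.AtPrime 𝔔.asIdeal) b) ∧
        𝔔.asIdeal.comap (algebraMap _ (blowupAlgebra (Ideal.span (Set.range fun i => (j.stalkMap x).hom (c i)))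
          ((j.stalkMap x).hom (c 0)))) = maximalIdeal (F₁.presheaf.stalk x) ∧
        ∀ (l : {l : Fin 3 // l ≠ 0}) (y : blowupAlgebra (Ideal.span (Set.range fun i => (j.stalkMap x).hom (c i)))
            ((j.stalkMap x).hom (c 0))),
          (y : Localization.Away ((j.stalkMap x).hom (c 0))) =
            algebraMap _ (Localization.Away ((j.stalkMap x).hom (c 0))) ((j.stalkMap x).hom (c l.1)) *
              IsLocalization.Away.invSelf ((j.stalkMap x).hom (c 0)) → y ∈ 𝔔.asIdeal) ∧
      -- the centred form
      1 ≤ m ∧ m ≤ d ∧ Φ.IsHomogeneous d ∧ (∀ α ∈ Φ.support, m ≤ α 1 + α 2) ∧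
      (∃ α ∈ Φ.support, α 1 + α 2 = m ∧ Φ.coeff α ∉ IsLocalRing.maximalIdeal O) ∧
      MvPolynomial.map (IsLocalRing.residue O) Φ ≠ 0 ∧
      MvPolynomial.map (Ideal.Quotient.mk (Ideal.span (Set.range c)))
        (MvPolynomial.map ((Scheme.ΓSpecIso (.of O)).inv ≫ r'.appTop ≫ X'.presheaf.Γgerm (j x)).hom Φ) ≠ 0 ∧
      MvPolynomial.map (Ideal.Quotient.mk (Ideal.span (Set.range fun i => (j.stalkMap x).hom (c i))))
        (MvPolynomial.map (j.stalkMap x).hom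
          (MvPolynomial.map ((Scheme.ΓSpecIso (.of O)).inv ≫ r'.appTop ≫ X'.presheaf.Γgerm (j x)).hom Φ)) ≠ 0 ∧
      -- Δ-regularity on the charts `T₁ = 1`, `T₂ = 1` (kit `ρ`-form)
      (∀ (ρ : X'.presheaf.stalk (j x) →+* O),
        ρ.comp ((Scheme.ΓSpecIso (.of O)).inv ≫ r'.appTop ≫ X'.presheaf.Γgerm (j x)).hom = RingHom.id O →
        ∀ (i : Fin 3), i ≠ 0 → ∀ (ϖ : O), Irreducible ϖ →
        ∀ (Q : Ideal (MvPolynomial {l : Fin 3 // l ≠ i} O ⧸ Ideal.span {MvPolynomial.map ρ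
          (dehomogenize i (MvPolynomial.map ((Scheme.ΓSpecIso (.of O)).inv ≫ r'.appTop ≫ X'.presheaf.Γgerm (j x)).hom Φ))}))
          [Q.IsPrime], Ideal.Quotient.mk _ (MvPolynomial.C ϖ : MvPolynomial {l : Fin 3 // l ≠ i} O) ∈ Q →
            IsRegularLocalRing (Localization.AtPrime Q)) ∧
      -- the strict transforms on the two charts of the blow-up of `[1:0:0]`, Δ-regular along every uniformizer
      MvPolynomial.aeval (![1, MvPolynomial.X 0, MvPolynomial.X 0 * MvPolynomial.X 1] : Fin 3 → MvPolynomial (Fin 2) O) Φ =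
        MvPolynomial.X 0 ^ m * Φu ∧
      MvPolynomial.aeval (![1, MvPolynomial.X 0 * MvPolynomial.X 1, MvPolynomial.X 1] : Fin 3 → MvPolynomial (Fin 2) O) Φ =
        MvPolynomial.X 1 ^ m * Φv ∧
      (∀ (ϖ : O), Irreducible ϖ → ∀ (Q : Ideal (MvPolynomial (Fin 2) O ⧸ Ideal.span {Φu})) [Q.IsPrime],
        Ideal.Quotient.mk (Ideal.span {Φu}) (MvPolynomial.C ϖ : MvPolynomial (Fin 2) O) ∈ Q →
          IsRegularLocalRing (Localization.AtPrime Q)) ∧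
      (∀ (ϖ : O), Irreducible ϖ → ∀ (Q : Ideal (MvPolynomial (Fin 2) O ⧸ Ideal.span {Φv})) [Q.IsPrime],
        Ideal.Quotient.mk (Ideal.span {Φv}) (MvPolynomial.C ϖ : MvPolynomial (Fin 2) O) ∈ Q →
          IsRegularLocalRing (Localization.AtPrime Q)) ∧
      -- the exact special fibre of every cone ideal with the germ `ι_*Φ(c)`
      (∀ K₀ : X'.IdealSheafData, stalkIdeal K₀ (j x) = Ideal.span {MvPolynomial.eval c
          (MvPolynomial.map ((Scheme.ΓSpecIso (.of O)).inv ≫ r'.appTop ≫ X'.presheaf.Γgerm (j x)).hom Φ)} →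
        (s.ker.comap τ₁ ⊔ strictTransformIdeal τ₁ s.ker K₀).comap j₂ =
          vanishingIdeal (⟨υ ⁻¹' {x} ∩ closure (υ ⁻¹' (W \ {x})), hZ⟩ : Closeds F₂) ∧
        -- (vii-loc) the special fibre of the cone is `St_x W` NEAR `υ⁻¹{x}` (res-D-pv-029 DECISION 2026-08-27T20:53:20Z)
        ∃ V : F₂.Opens, (υ ⁻¹' {x} : Set F₂) ⊆ (V : Set F₂) ∧
          ((strictTransformIdeal τ₁ s.ker K₀).comap j₂).comap V.ι =
            (vanishingIdeal (⟨closure (υ ⁻¹' (W \ {x})), isClosed_closure⟩ : Closeds F₂)).comap V.ι) := by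
  classical
  haveI : IsClosedImmersion (Spec.map (CommRingCat.ofHom θ)) := IsClosedImmersion.spec_of_surjective _ hθ
  haveI : IsClosedImmersion j := MorphismProperty.IsStableUnderBaseChange.of_isPullback hsq.flip inferInstance
  haveI : IsLocallyNoetherian X₁ := by
    haveI : IsProper τ₁ := hτ₁.isProper
    exact LocallyOfFiniteType.isLocallyNoetherian τ₁
  haveI : IsLocallyNoetherian F₁ := LocallyOfFiniteType.isLocallyNoetherian j
  haveI : IsLocallyNoetherian F₂ := by
    haveI : IsProper υ := hυ.isProper
    exact LocallyOfFiniteType.isLocallyNoetherian υ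
  have hy'x : υ y' = x := hy'.1
  refine (IsDiscreteValuationRing.exists_irreducible O).elim fun ϖ hϖ => ?_
  have hϖO : ϖ ∈ maximalIdeal O := by rw [hϖ.maximalIdeal_eq]; exact Ideal.mem_span_singleton_self ϖ
  -- (S1″) the `ConeForm` frame (`m = 3`), its section-frame LIFT (res-D-pv-051), T-FRAME-AT′ (translate-and-swap by CONSTANTS)
  rw [hss] at hdim4
  refine (exists_sectionFrame_forall_dim_at O r' s hs (j x) hss (hregX (j x)) ϖ hϖ).elim fun n₁ H₁ => H₁.elim fun c₁ H₁ =>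
    H₁.elim fun θ₁ H₁ => ?_
  have hdimF := ringKrullDim_stalk_succ_eq_of_model O k θ hθ r' j t hsq x ϖ hϖ c₁ H₁.2.2.2.2.1 H₁.2.2.2.2.2.1
  clear H₁
  refine hcone.elim fun m Hc => Hc.elim fun d Hc => Hc.elim fun cφ Hc => Hc.elim fun φ Hc => ?_
  have hspan := Hc.1
  have hdimm := Hc.2.1
  have hφd := Hc.2.2.2.1
  have hroot := Hc.2.2.2.2.1
  have hW₀ := Hc.2.2.2.2.2
  clear Hc
  have hmn : m + 1 = 3 + 1 := by
    rw [hdimm, hdim4] at hdimF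
    exact_mod_cast hdimF
  obtain rfl : m = 3 := by omega
  refine (exists_sectionFrame_lift_model O k θ hθ r' s hs j t hsq x hss (hregX (j x)) ϖ hϖ cφ hspan).elim fun c₀ Hc₀ => ?_
  have hcI₀ := Hc₀.1
  have hcφ : cφ = fun i => (j.stalkMap x).hom (c₀ i) := funext fun i => (Hc₀.2 i).symm
  clear Hc₀
  subst hcφ
  -- destructure with `.elim` and projections only (the chart algebra in the conclusion makes `obtain` time out)
  refine (exists_sectionFrame_adapted_of_frame O k θ hθ r' s hs j t hsq x hx hss (hregX (j x)) hdim4 ϖ hϖ υ hυ y' hy'x hy'c c₀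
    hcI₀).elim fun c H => H.elim fun θR H => ?_
  have hcI := H.1
  have hqr := H.2.1
  have hdom := H.2.2.1
  have hθR := H.2.2.2.1
  have h𝔪 := H.2.2.2.2.1
  have hϖc := H.2.2.2.2.2.1
  have Hrel := H.2.2.2.2.2.2.1
  have Hp := H.2.2.2.2.2.2.2
  clear H
  haveI := hdom
  -- the model frame downstairs
  have hcb𝔪 := span_stalkMap_eq_maximalIdeal_of_model θ hθ r' j t hsq x ϖ hϖO c h𝔪
  have hcbar := isQuasiRegular_stalkMap_model O k θ hθ r' j t hsq x c hqr ϖ hϖ hϖc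
  haveI hFreg : IsRegularLocalRing (F₁.presheaf.stalk x) :=
    isRegularLocalRing_stalk_of_model O k θ hθ r' j t hsq x (hregX (j x)) ϖ hϖ c h𝔪 hϖc
  have hJ : s.ker.comap j = vanishingIdeal ⟨{x}, hx⟩ :=
    comap_ker_eq_vanishingIdeal_of_model θ hθ r' s hs j t hsq x hx hss c hcI hcb𝔪
  haveI hmax : (Ideal.span (Set.range fun i => (j.stalkMap x).hom (c i))).IsMaximal := by
    rw [hcb𝔪]; exact maximalIdeal.isMaximal _
  have hframe : ∀ ϖ' : O, Irreducible ϖ' →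
      Ideal.span (Set.range c) ⊔ Ideal.span {(X'.presheaf.Γgerm (j x)).hom (r'.appTop.hom ((Scheme.ΓSpecIso (.of O)).inv.hom ϖ'))} =
        maximalIdeal (X'.presheaf.stalk (j x)) ∧
      (X'.presheaf.Γgerm (j x)).hom (r'.appTop.hom ((Scheme.ΓSpecIso (.of O)).inv.hom ϖ')) ∉ Ideal.span (Set.range c) := by
    intro ϖ' hϖ'
    obtain ⟨θ', -, -, -, h𝔪', hϖc'⟩ := exists_sectionFrame_of_span_eq_forall_at O r' s hs (j x) hss (hregX (j x)) ϖ' hϖ' c hcI hdim4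
    exact ⟨h𝔪', hϖc'⟩
  -- (S2‴) the cone form of `W` TRANSPORTED to the adapted frame (…NatConeFormTransport): a constant-coefficient form `Φ₁ = ρ_*Ψ`
  refine Hrel.elim fun jj Hrel => Hrel.elim fun o hrel => ?_
  refine (exists_coneForm_transport O p k θ hθ r' j t hsq x hx υ hυ c c₀ θR hθR hcb𝔪 jj o hrel W hnot φ hφd hroot hW₀).elim
    fun hsurjρ Htr => Htr.elim fun hkerρ Htr => Htr.elim fun Ψ Htr => Htr.elim fun Φ₁ HΦ₁ => ?_
  have hΦ₁def := HΦ₁.1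
  have hΦ₁d := HΦ₁.2.1
  have hW := HΦ₁.2.2.1
  have hΦ₁0 := HΦ₁.2.2.2
  clear HΦ₁ Hrel
  refine (exists_isHomogeneous_squarefree_reduction (fun i => (j.stalkMap x).hom (c i)) hmax Φ₁ hΦ₁d hΦ₁0).elim
    fun d' HG => HG.elim fun G HG => ?_
  have hGd' := HG.1
  have hG0 := HG.2.1
  have hGsq := HG.2.2.1
  have hR1 := HG.2.2.2.1
  have hR1' := HG.2.2.2.2.1
  have hR2 := HG.2.2.2.2.2.1
  have hR2sq := HG.2.2.2.2.2.2
  clear HG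
  letI : Field (F₁.presheaf.stalk x ⧸ Ideal.span (Set.range fun i => (j.stalkMap x).hom (c i))) :=
    Ideal.Quotient.field _
  refine (⟨_, rfl⟩ : ∃ g, g = MvPolynomial.map (Ideal.Quotient.mk (Ideal.span (Set.range fun i => (j.stalkMap x).hom (c i)))) G).elim
    fun g hgdef => ?_
  have hgd : g.IsHomogeneous d' := hgdef ▸ hGd'.map _
  have hg0 : g ≠ 0 := hgdef ▸ hG0
  -- (S2′) the multiplicity `m` of `g` at `[1:0:0]`
  have hsuppne : (g.support.image fun α : Fin 3 →₀ ℕ => α 1 + α 2).Nonempty :=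
    Finset.Nonempty.image (MvPolynomial.support_nonempty.mpr hg0) _
  refine (⟨_, rfl⟩ : ∃ m, m = (g.support.image fun α : Fin 3 →₀ ℕ => α 1 + α 2).min' hsuppne).elim fun m hmdef => ?_
  have hcen : ∀ α ∈ g.support, m ≤ α 1 + α 2 := fun α hα =>
    hmdef ▸ Finset.min'_le _ _ (Finset.mem_image_of_mem _ hα)
  have hexact : ∃ α ∈ g.support, α 1 + α 2 = m := by
    obtain ⟨α, hα, h⟩ := Finset.mem_image.mp (hmdef ▸ Finset.min'_mem _ hsuppne)
    exact ⟨α, hα, h⟩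
  have hmd : m ≤ d' := by
    obtain ⟨α, hα, h⟩ := hexact
    have hdeg : α.degree = d' := by
      by_contra h'
      exact (MvPolynomial.mem_support_iff.mp hα) (hgd.coeff_eq_zero h')
    rw [← h, ← hdeg, Finsupp.degree_eq_sum, Fin.sum_univ_three]
    omega
  -- `m ≥ 1`: `y′` lies on the trace, so `g(1,0,0) = 0` (`coeff_mem_of_mem_carrierTrace` on the adapted presentation)
  have hm1 : 1 ≤ m := by
    have hZ' : IsClosed (υ ⁻¹' {x} ∩ closure (υ ⁻¹' (((⟨closure W, isClosed_closure⟩ : Closeds F₁) : Set F₁) \ {x}))) := by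
      rw [Closeds.coe_mk, ← closure_preimage_diff_singleton_eq_of_isBlowup hx hυ W]; exact hZ
    have hy'' : y' ∈ υ ⁻¹' {x} ∩ closure (υ ⁻¹' (((⟨closure W, isClosed_closure⟩ : Closeds F₁) : Set F₁) \ {x})) := by
      rw [Closeds.coe_mk, ← closure_preimage_diff_singleton_eq_of_isBlowup hx hυ W]; exact hy'
    have hcoeff := coeff_mem_of_mem_carrierTrace hx y' hy'x (fun i => (j.stalkMap x).hom (c i)) hcb𝔪 hcbar
      ⟨closure W, isClosed_closure⟩ Φ₁ G hΦ₁d hΦ₁0 hW hR1 hR1' hR2 hGd' hZ' hy'' Hp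
    have hg00 : g.coeff (Finsupp.single 0 d') = 0 := by
      rw [hgdef, MvPolynomial.coeff_map, Ideal.Quotient.eq_zero_iff_mem]
      exact hcoeff
    refine hexact.elim fun α hα => ?_
    rw [← hα.2]
    by_contra hlt
    have h0 : α 1 + α 2 = 0 := by omega
    have hdeg : α.degree = d' := by
      by_contra h'
      exact (MvPolynomial.mem_support_iff.mp hα.1) (hgd.coeff_eq_zero h')
    have hα' := hα.1
    rw [eq_single_of_degree_eq hdeg h0] at hα'
    exact (MvPolynomial.mem_support_iff.mp hα') hg00
  -- (S3) the residue model `π₀ : O ↠ k₀ = 𝒪_{F₁,x}/(c̄)`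
  refine (⟨_, rfl⟩ : ∃ π₀ : O →+* F₁.presheaf.stalk x ⧸ Ideal.span (Set.range fun i => (j.stalkMap x).hom (c i)),
      π₀ = ((Ideal.Quotient.mk (Ideal.span (Set.range fun i => (j.stalkMap x).hom (c i)))).comp
        (j.stalkMap x).hom).comp ((Scheme.ΓSpecIso (.of O)).inv ≫ r'.appTop ≫ X'.presheaf.Γgerm (j x)).hom).elim
    fun π₀ hπ₀def => ?_
  have hπ₀ := (residueModel_surjective_and_ker θ hθ r' j t hsq x c θR hθR hcb𝔪 hπ₀def).1
  have hkerπ₀ := (residueModel_surjective_and_ker θ hθ r' j t hsq x c θR hθR hcb𝔪 hπ₀def).2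
  haveI : Infinite (F₁.presheaf.stalk x ⧸ Ideal.span (Set.range fun i => (j.stalkMap x).hom (c i))) := by
    haveI : Infinite (ResidueField O) := inferInstance
    exact Infinite.of_injective (β := ResidueField O)
      ((Ideal.quotEquivOfEq hkerπ₀.symm).trans (RingHom.quotientKerEquivOfSurjective hπ₀))
      ((Ideal.quotEquivOfEq hkerπ₀.symm).trans (RingHom.quotientKerEquivOfSurjective hπ₀)).injective
  have hρ₀ : (θR.toRingHom.comp (Ideal.Quotient.mk (Ideal.span (Set.range c)))).comp
      ((Scheme.ΓSpecIso (.of O)).inv ≫ r'.appTop ≫ X'.presheaf.Γgerm (j x)).hom = RingHom.id O :=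
    RingHom.ext fun b => hθR b
  -- (S3′) T-ΔLIFT-CENTRED: finiteness on the charts `1`, `2` from square-freeness, on the strict transforms from stub-4's SQF
  have hfin : ∀ i : Fin 3, {𝔮 : PrimeSpectrum (MvPolynomial {l : Fin 3 // l ≠ i}
      (F₁.presheaf.stalk x ⧸ Ideal.span (Set.range fun i => (j.stalkMap x).hom (c i)))) |
      dehomogenize i g ∈ 𝔮.asIdeal ∧ algebraMap _ (Localization.AtPrime 𝔮.asIdeal) (dehomogenize i g) ∈
        maximalIdeal (Localization.AtPrime 𝔮.asIdeal) ^ 2}.Finite := fun i => by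
    have hsq : Squarefree (dehomogenize i g) := by
      have h := hR2sq i
      rw [map_dehomogenize, ← hgdef] at h
      exact h
    exact finite_setOf_mem_sq_chart i (fun h => not_squarefree_zero ((congrArg Squarefree h).mp hsq)) hsq
  have Hgu : ∃ gu : MvPolynomial (Fin 2) (F₁.presheaf.stalk x ⧸ Ideal.span (Set.range fun i => (j.stalkMap x).hom (c i))),
      MvPolynomial.aeval (![1, MvPolynomial.X 0, MvPolynomial.X 0 * MvPolynomial.X 1] : Fin 3 → MvPolynomial (Fin 2) _) g =
        MvPolynomial.X 0 ^ m * gu := by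
    obtain ⟨a, ha⟩ := Ideal.mem_span_singleton'.mp (aeval_mem_span_pow_of_forall_le
      (![1, MvPolynomial.X 0, MvPolynomial.X 0 * MvPolynomial.X 1] : Fin 3 → MvPolynomial (Fin 2) _) (MvPolynomial.X 0)
      (X_dvd_chartU_one (R := F₁.presheaf.stalk x ⧸ Ideal.span (Set.range fun i => (j.stalkMap x).hom (c i)))) (X_dvd_chartU_two (R := F₁.presheaf.stalk x ⧸ Ideal.span (Set.range fun i => (j.stalkMap x).hom (c i)))) g hcen)
    exact ⟨a, by rw [← ha, mul_comm]⟩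
  have Hgv : ∃ gv : MvPolynomial (Fin 2) (F₁.presheaf.stalk x ⧸ Ideal.span (Set.range fun i => (j.stalkMap x).hom (c i))),
      MvPolynomial.aeval (![1, MvPolynomial.X 0 * MvPolynomial.X 1, MvPolynomial.X 1] : Fin 3 → MvPolynomial (Fin 2) _) g =
        MvPolynomial.X 1 ^ m * gv := by
    obtain ⟨a, ha⟩ := Ideal.mem_span_singleton'.mp (aeval_mem_span_pow_of_forall_le
      (![1, MvPolynomial.X 0 * MvPolynomial.X 1, MvPolynomial.X 1] : Fin 3 → MvPolynomial (Fin 2) _) (MvPolynomial.X 1)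
      (X_dvd_chartV_one (R := F₁.presheaf.stalk x ⧸ Ideal.span (Set.range fun i => (j.stalkMap x).hom (c i)))) (X_dvd_chartV_two (R := F₁.presheaf.stalk x ⧸ Ideal.span (Set.range fun i => (j.stalkMap x).hom (c i)))) g hcen)
    exact ⟨a, by rw [← ha, mul_comm]⟩
  refine Hgu.elim fun gu hgu => Hgv.elim fun gv hgv => ?_
  have hgsq : Squarefree g := by rw [hgdef]; exact hGsq
  have hfinu := finite_setOf_mem_sq_strictTransform_fst_of_squarefree hgd hexact hgsq hgu
  have hfinv := finite_setOf_mem_sq_strictTransform_snd_of_squarefree hgd hexact hgsq hgv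
  refine (exists_isHomogeneous_centred_lift_deltaRegular hϖ π₀ hπ₀ (hkerπ₀.trans hϖ.maximalIdeal_eq) hmd g hgd hcen (hfin 1)
    (hfin 2) gu gv hgu hgv hfinu hfinv).elim fun Φ HΦ => ?_
  have hΦd := HΦ.1
  have hΦg := HΦ.2.1
  have hΦcen := HΦ.2.2.1
  refine HΦ.2.2.2.elim fun Φu HΦ' => HΦ'.elim fun Φv HΦ' => ?_
  have hΦu := HΦ'.1
  have hΦv := HΦ'.2.1
  have hreg1 := HΦ'.2.2.2.2.1
  have hreg2 := HΦ'.2.2.2.2.2.1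
  have hregu := HΦ'.2.2.2.2.2.2.1
  have hregv := HΦ'.2.2.2.2.2.2.2
  clear HΦ HΦ'
  -- consequences: `Φ ≢ 0 mod 𝔪_O`, `ι_* Φ ≢ 0 mod (c)`, `j^♯ ι_* Φ ≡ g mod (c̄)`
  have hΦres : MvPolynomial.map (IsLocalRing.residue O) Φ ≠ 0 := fun h => hg0 (by
    rw [← hΦg]
    refine map_eq_zero_of_coeff_mem_ker π₀ fun n => ?_
    rw [hkerπ₀, ← IsLocalRing.ker_residue]
    exact coeff_mem_ker_of_map_eq_zero (IsLocalRing.residue O) h n)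
  have hΦne : Φ ≠ 0 := fun h0 => hg0 (by rw [← hΦg, h0, map_zero])
  -- (S2″) the exact-order clause: `m` is attained on the support of `g = π₀_* Φ`, and `ker π₀ = 𝔪_O`
  have hΦexact : ∃ α ∈ Φ.support, α 1 + α 2 = m ∧ Φ.coeff α ∉ IsLocalRing.maximalIdeal O := by
    obtain ⟨α, hα, hαm⟩ := hexact
    have hne : g.coeff α ≠ 0 := MvPolynomial.mem_support_iff.mp hα
    rw [← hΦg, MvPolynomial.coeff_map] at hne
    refine ⟨α, MvPolynomial.mem_support_iff.mpr (fun h0 => hne (by rw [h0, map_zero])), hαm, fun hmem => hne ?_⟩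
    rw [← RingHom.mem_ker, hkerπ₀]
    exact hmem
  have hΦι : MvPolynomial.map (Ideal.Quotient.mk (Ideal.span (Set.range c)))
      (MvPolynomial.map ((Scheme.ΓSpecIso (.of O)).inv ≫ r'.appTop ≫ X'.presheaf.Γgerm (j x)).hom Φ) ≠ 0 := by
    intro h
    apply hΦne
    have h2 := congrArg (MvPolynomial.map θR.toRingHom) h
    rwa [MvPolynomial.map_map, MvPolynomial.map_map, hρ₀, MvPolynomial.map_id, map_zero] at h2
  have hΦbg : MvPolynomial.map (Ideal.Quotient.mk (Ideal.span (Set.range fun i => (j.stalkMap x).hom (c i))))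
      (MvPolynomial.map (j.stalkMap x).hom
        (MvPolynomial.map ((Scheme.ΓSpecIso (.of O)).inv ≫ r'.appTop ≫ X'.presheaf.Γgerm (j x)).hom Φ)) = g := by
    rw [MvPolynomial.map_map, MvPolynomial.map_map, ← hπ₀def, hΦg]
  have hΦbgG : MvPolynomial.map (Ideal.Quotient.mk (Ideal.span (Set.range fun i => (j.stalkMap x).hom (c i))))
      (MvPolynomial.map (j.stalkMap x).hom
        (MvPolynomial.map ((Scheme.ΓSpecIso (.of O)).inv ≫ r'.appTop ≫ X'.presheaf.Γgerm (j x)).hom Φ)) =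
      MvPolynomial.map (Ideal.Quotient.mk (Ideal.span (Set.range fun i => (j.stalkMap x).hom (c i)))) G := hΦbg.trans hgdef
  have hΦbar : MvPolynomial.map (Ideal.Quotient.mk (Ideal.span (Set.range fun i => (j.stalkMap x).hom (c i))))
      (MvPolynomial.map (j.stalkMap x).hom
        (MvPolynomial.map ((Scheme.ΓSpecIso (.of O)).inv ≫ r'.appTop ≫ X'.presheaf.Γgerm (j x)).hom Φ)) ≠ 0 := by
    rw [hΦbg]; exact hg0
  have hΦιd : (MvPolynomial.map ((Scheme.ΓSpecIso (.of O)).inv ≫ r'.appTop ≫ X'.presheaf.Γgerm (j x)).hom Φ).IsHomogeneous d' :=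
    hΦd.map _
  refine ⟨c, θR, d', m, Φ, Φu, Φv, hcI, hqr, hdom, hθR, hframe, hcb𝔪, hcbar, Hp, hm1, hmd, hΦd,
    hΦcen, hΦexact, hΦres, hΦι, hΦbar, ?_, hΦu, hΦv, ?_, ?_, fun K₀ hK => ⟨?_, ?_⟩⟩
  · -- Δ-regularity on the charts `1`, `2`, transported to an arbitrary retraction `ρ` and uniformizer
    intro ρ hρ i hi ϖ' hϖ' Q _ hQ
    have hregi : ∀ (Q : Ideal (MvPolynomial {l : Fin 3 // l ≠ i} O ⧸ Ideal.span {dehomogenize i Φ})) [Q.IsPrime],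
        Ideal.Quotient.mk (Ideal.span {dehomogenize i Φ}) (MvPolynomial.C ϖ : MvPolynomial {l : Fin 3 // l ≠ i} O) ∈ Q →
          IsRegularLocalRing (Localization.AtPrime Q) := by
      intro Q hQi hQ
      fin_cases i
      · exact absurd rfl hi
      · exact @hreg1 Q hQi hQ
      · exact @hreg2 Q hQi hQ
    -- the uniformizer is irrelevant (…NatConeFormTransport `map_mem_of_irreducible_of_map_mem`)
    exact forall_ideal_quotient_span_singleton_congr (map_dehomogenize_map_of_comp_eq_id _ ρ hρ i Φ) (MvPolynomial.C ϖ')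
      (fun Q hQi hQ' => @hregi Q hQi (map_mem_of_irreducible_of_map_mem
        ((Ideal.Quotient.mk (Ideal.span {dehomogenize i Φ})).comp MvPolynomial.C) hϖ hϖ' (Q := Q) hQ')) Q hQ
  · exact fun ϖ' hϖ' Q _ hQ => @hregu Q ‹_›
      (map_mem_of_irreducible_of_map_mem ((Ideal.Quotient.mk (Ideal.span {Φu})).comp MvPolynomial.C) hϖ hϖ' (Q := Q) hQ)
  · exact fun ϖ' hϖ' Q _ hQ => @hregv Q ‹_›
      (map_mem_of_irreducible_of_map_mem ((Ideal.Quotient.mk (Ideal.span {Φv})).comp MvPolynomial.C) hϖ hϖ' (Q := Q) hQ)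
  · -- the exact special fibre: (v), then T-TCONE (2) for `closure W`, then `closure W ↦ W` (verbatim from HΔTC / part 1b)
    have hZ' : IsClosed (υ ⁻¹' {x} ∩ closure (υ ⁻¹' (((⟨closure W, isClosed_closure⟩ : Closeds F₁) : Set F₁) \ {x}))) := by
      rw [Closeds.coe_mk, ← closure_preimage_diff_singleton_eq_of_isBlowup hx hυ W]; exact hZ
    have hcl : (⟨υ ⁻¹' {x} ∩ closure (υ ⁻¹' (W \ {x})), hZ⟩ : Closeds F₂) =
        ⟨υ ⁻¹' {x} ∩ closure (υ ⁻¹' (((⟨closure W, isClosed_closure⟩ : Closeds F₁) : Set F₁) \ {x})), hZ'⟩ :=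
      Closeds.ext (by rw [Closeds.coe_mk, Closeds.coe_mk, Closeds.coe_mk, closure_preimage_diff_singleton_eq_of_isBlowup hx hυ W])
    rw [show s.ker.comap τ₁ ⊔ strictTransformIdeal τ₁ s.ker K₀ = strictTransformIdeal τ₁ s.ker K₀ ⊔ s.ker.comap τ₁ from
      sup_comm _ _, comap_strictTransformIdeal_sup_comap_eq_of_model τ₁ s.ker _ hτ₁ j υ j₂ hcomm x hx hυ hJ c hcI hqr _ hΦιd
      hΦι hK hcbar hΦbar]
    have hK' : stalkIdeal (K₀.comap j) x =
        Ideal.span {MvPolynomial.eval (fun i => (j.stalkMap x).hom (c i)) (MvPolynomial.map (j.stalkMap x).hom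
          (MvPolynomial.map ((Scheme.ΓSpecIso (.of O)).inv ≫ r'.appTop ≫ X'.presheaf.Γgerm (j x)).hom Φ))} := by
      rw [stalkIdeal_comap_eq_map_stalkMap, hK, Ideal.map_span, Set.image_singleton, ringHom_eval_eq_eval_map]
    rw [hcl]
    exact (vanishingIdeal_carrierTrace_eq_strictTransformIdeal_sup_comap hx hυ (fun i => (j.stalkMap x).hom (c i)) hcb𝔪 hcbar
      ⟨closure W, isClosed_closure⟩ _ Φ₁ _ hΦ₁d (hΦιd.map _) hΦ₁0 hΦbar hW hK' (by rw [hΦbgG]; exact hR1)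
      (by rw [hΦbgG]; exact hR1') (fun i => by rw [map_dehomogenize, hΦbgG, ← map_dehomogenize]; exact hR2 i) hZ').symm

  · -- (vii-loc): the germ identity `(K₀·𝒪_{F₁})_x = 𝓘⟨closure W⟩_x` (…NatConeFormConstants), then …NatConeShadowLocal
    have hK' : stalkIdeal (K₀.comap j) x =
        Ideal.span {MvPolynomial.eval (fun i => (j.stalkMap x).hom (c i)) (MvPolynomial.map (j.stalkMap x).hom
          (MvPolynomial.map ((Scheme.ΓSpecIso (.of O)).inv ≫ r'.appTop ≫ X'.presheaf.Γgerm (j x)).hom Φ))} := by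
      rw [stalkIdeal_comap_eq_map_stalkMap, hK, Ideal.map_span, Set.image_singleton, ringHom_eval_eq_eval_map]
    have hexact' : Ideal.span {MvPolynomial.eval (fun i => (j.stalkMap x).hom (c i)) (MvPolynomial.map (j.stalkMap x).hom
        (MvPolynomial.map ((Scheme.ΓSpecIso (.of O)).inv ≫ r'.appTop ≫ X'.presheaf.Γgerm (j x)).hom Φ))} =
        Ideal.span {MvPolynomial.eval (fun i => (j.stalkMap x).hom (c i)) Φ₁} := by
      rw [MvPolynomial.map_map]
      refine span_eval_map_eq_of_reduction_of_map_eq _ (Ideal.Quotient.mk _) hsurjρ hkerρ _ Ψ Φ₁ hΦ₁def.symm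
        (by rw [← hW]; exact isRadical_stalkIdeal_vanishingIdeal _ _) Φ ?_ ?_
      · rw [← MvPolynomial.map_map, ← MvPolynomial.map_map, hΦbgG]
        exact dvd_of_mem_radical_span_of_squarefree hGsq hR1
      · rw [← MvPolynomial.map_map, ← MvPolynomial.map_map, hΦbgG]
        exact hR1'
    have hKW : stalkIdeal (K₀.comap j) x = stalkIdeal (vanishingIdeal (⟨closure W, isClosed_closure⟩ : Closeds F₁)) x := by
      rw [hK', hexact', hW]
    exact exists_nhd_comap_strictTransformIdeal_eq_vanishingIdeal_of_model τ₁ s.ker K₀ hτ₁ j υ j₂ hcomm x hx hυ hJ c hcI hqr _ hΦιd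
      hΦι hK hcbar hΦbar W hKW

end Centred

end Summit.ResolutionOfSingularities.ResolutionOfSingularities.Cruxes.EquisingularLiftNat.Sections

end
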